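import Summits.CriticalPhenomena.CardyFormulaZ2.Theses.CardySelfRefinement
import Literature.Probability.RandomPlanarGeometry.SLEUniquenessInLaw

/-!
# Skeleton line `uniqueness-subsequence-principle` for crux `SubseqUpgrade` (stmt-CriticalPhenomena-10279)

Route `CardySelfRefinement`, sub-problem `CardyFormulaZ2`. Crux-plan skeleton (planner
`cruxplan-stmt-CriticalPhenomena-10279-uniqueness-subsequen`, 2026-08-16): TWO registered stubs
`stub_seqCriterion`, `stub_uniqueLawIntegral` (sorried here; both already have kernel-checked
proofs, see the line card and the evidence file `SkeletonComplete.lean`) and the sorry-free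
composition `SubseqUpgrade_of`, whose conclusion is literally the route decl
`Summit.CriticalPhenomena.CardyFormulaZ2.Theses.CardySelfRefinement.SubseqUpgrade`.

## The line in one paragraph

The crux says: if (H1) the bond-ℤ² exploration interfaces are eventually a.e.-measurable and
(H2) along every everywhere-positive null sequence of meshes some strictly increasing subsequence
makes the interfaces of EVERY admissible `(D, E)` converge in law (portmanteau form) to a family of
chordal SLE₆ laws, then for every `(D, E)` the interface `ConvergesInLawToSLE 6 D`. Unfolding,
`ConvergesInLawToSLE κ D Y P = ∃ Γ, IsSLECurve κ D Γ ∧ (∀ᶠ δ, AEMeasurable (Y δ) (P δ)) ∧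
∀ f : CurveClass ℂ →ᵇ ℝ, Tendsto (δ ↦ ∫ f (Y δ ω) dP δ) (𝓝[>] 0) (𝓝 ∫ f (Γ ω) d preWiener)`:
a family of REAL limits along the countably generated filter `𝓝[>] 0`. Two lemmas carry it and
they are the two stubs: **S2** (`stub_uniqueLawIntegral`, the load-bearing input) — every chordal
SLE_κ law of `(D; a, b)` integrates every bounded continuous test function exactly like the law of
any SLE_κ random curve `Γ` in `D` (uniqueness in law, portmanteau form; in tree this is
`IsSLELaw.eq_map_of_isSLECurve` + `integral_map`), so all the subsequential limit laws handed out
by (H2) have ONE common value per test function; and **S1** (`stub_seqCriterion`) — the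
subsequence criterion along `𝓝[>] 0` with the positivity guard of (H2): a real function of the
mesh tends to `L` along `𝓝[>] 0` as soon as every everywhere-positive null sequence has a
strictly increasing subsequence along which it tends to `L` (Billingsley 1999, Thm 2.6, filter
core = Mathlib `Filter.tendsto_of_subseq_tendsto` after patching finitely many non-positive
meshes). The composition extracts the witness `Γ` from (H2) on the harmonic mesh sequence
`1/(n+1)`, proves the model-free TRANSFER `convergesInLawToSLE_of_forall_pos_seq` (C⁺ of the idea
card) from S1 + S2, and instantiates it at `κ = 6`, `Y δ = bondInterfaceIn D (E δ)`,
`P δ = bondPercolation (zdGraph 2) half` — four lines.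

## Disproof used (`Cruxes/SubseqUpgrade/Disproof.lean`, refuter-cdisprove-…-10279-0, 2026-08-16T02:27Z)

* `not_subseqPrinciple_pair` / `subseqPrinciple_of_subsingleton` — the `_false_without_<uniqueness
  of the limit law>` obstruction: with a two-point target set the subsequence principle FAILS
  (witness `oscillator`). HONOURED: the line uses uniqueness exactly at `stub_uniqueLawIntegral`,
  consumed in `convergesInLawToSLE_of_forall_pos_seq` (the `rw [← h₂ …]` step) before S1 is
  invoked; S1 itself is stated with a SINGLE target `L`, the subsingleton case.
* `exists_pos_seq_eventuallyEq` — the positivity repair; it is the content of S1's guard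
  `(∀ n, 0 < s n)` (S1's proof patches non-positive meshes, cf. the complete file).
* `convergesInLawToSLE_of_subseq`, `subseqUpgradePerDomain_holds` — "one φ / one family `P` for
  all `(D, E)`" and `StrictMono φ` are NOT load-bearing: consistent, the composition specialises
  (H2) to the pair `(D, E)` at hand and never uses uniformity.
* `subseqUpgrade_holds'` (§Positive) — an independent sorry-free proof of the crux; nothing in the
  Disproof is a refuted strengthening or a near-miss to avoid; `-- Targets: none`.
* No landed `Theorems/SubseqUpgrade/Negative/*` lemma exists (nothing to import or check against).
Upstream (`Cruxes/LagHandOff/Disproof.lean`): `conclusion_false_without_mesh_positivity`,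
`conclusion_false_without_discretisation_guard` explain the guards `∀ n, 0 < δs n` and
`ZdDiscretisationFamily D E →` inside (H2); the composition applies (H2) only to positive sequences
and only at admissible `(D, E)`.
-/

open Filter Topology MeasureTheory
open scoped NNReal BoundedContinuousFunction

namespace Summit.CriticalPhenomena.CardyFormulaZ2.Cruxes.SubseqUpgrade.UniquenessSubsequencePrinciple

open Literature.Probability.RandomPlanarGeometry

/-! ### The two statements of the line -/

/-- **S1 — the subsequence criterion along the mesh filter `𝓝[>] 0`, positivity-guarded.**
A real function `x` of the mesh tends to `L` along `𝓝[>] 0` as soon as along every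
EVERYWHERE-POSITIVE sequence of meshes `s n → 0` some strictly increasing subsequence `φ` gives
`x (s (φ n)) → L`. Filter core: Mathlib `Filter.tendsto_of_subseq_tendsto` (the filter `𝓝[>] 0`
is countably generated); the guard `∀ n, 0 < s n` (a sequence tending to `𝓝[>] 0` is only
EVENTUALLY positive) is repaired by patching finitely many values, and `StrictMono φ` transports
the eventual equality (`StrictMono.tendsto_atTop`). Billingsley (1999), Thm 2.6 (real-valued
case). Size S/M (≈ 15 tactic lines; proved in `SkeletonComplete.lean`). -/
def SeqCriterion : Prop :=
  ∀ (x : ℝ → ℝ) (L : ℝ),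
    (∀ s : ℕ → ℝ, (∀ n, 0 < s n) → Tendsto s atTop (𝓝 0) →
        ∃ φ : ℕ → ℕ, StrictMono φ ∧ Tendsto (fun n => x (s (φ n))) atTop (𝓝 L)) →
      Tendsto x (𝓝[>] (0 : ℝ)) (𝓝 L)

/-- **S2 — uniqueness in law of chordal SLE_κ in a Dobrushin domain, portmanteau form (the
load-bearing input, cf. `Disproof.not_subseqPrinciple_pair`).** If `μ` is a chordal SLE_κ law of
`(D; a, b)` and `Γ` is a chordal SLE_κ random curve in `D`, then `μ` integrates every bounded
continuous test function exactly like the law of `Γ`. In tree: `IsSLELaw.eq_map_of_isSLECurve`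
(`SLEUniquenessInLaw.lean`, PROVED from `IsSLECurve.map_eq_holds`: uniqueness of chordal
uniformizers up to dilation + Carathéodory + SLE scaling at the given `κ`) followed by
`MeasureTheory.integral_map`. Lawler (2005), §6.1/§6.3; Rohde–Schramm (2005), Prop. 2.1 (i).
Size S given the tree theorem (2 lines; proved in `SkeletonComplete.lean`), L intrinsically. -/
def UniqueLawIntegral : Prop :=
  ∀ (κ : ℝ≥0) (D : DobrushinDomain) (μ : Measure (CurveClass ℂ)) (Γ : (ℝ≥0 → ℝ) → CurveClass ℂ),
    IsSLELaw κ D μ → IsSLECurve κ D Γ →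
      ∀ f : CurveClass ℂ →ᵇ ℝ,
        ∫ x, f x ∂μ = ∫ ω, f (Γ ω) ∂Literature.Probability.Process.preWienerMeasure

/-! ### Registered stubs -/

/-- **stub_seqCriterion** (S1, size S/M): the subsequence criterion along `𝓝[>] 0` with the
positivity guard. See `SeqCriterion`. -/
theorem stub_seqCriterion : SeqCriterion := by
  sorry

/-- **stub_uniqueLawIntegral** (S2, size S given `IsSLELaw.eq_map_of_isSLECurve`; the
load-bearing input of the line): uniqueness in law of chordal SLE_κ, portmanteau form. See
`UniqueLawIntegral`. -/
theorem stub_uniqueLawIntegral : UniqueLawIntegral := by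
  sorry

/-! ### Name-keyed aliases of the two statements

The hypotheses of the composition: the skeleton audit admits a hypothesis only if its head
constant is a registered obligation or is named like a declared stub. -/
namespace Registered

/-- Alias of `SeqCriterion` keyed by the registered stub name. -/
abbrev stub_seqCriterion : Prop := SeqCriterion

/-- Alias of `UniqueLawIntegral` keyed by the registered stub name. -/
abbrev stub_uniqueLawIntegral : Prop := UniqueLawIntegral

end Registered

/-! ### Transfer C⁺ (model-free, any `κ`), proved from S1 + S2 -/

section Transfer

variable {κ : ℝ≥0} {D : DobrushinDomain} {Ωδ : ℝ → Type*} [∀ δ, MeasurableSpace (Ωδ δ)]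
  {Y : ∀ δ, Ωδ δ → CurveClass ℂ} {P : ∀ δ, Measure (Ωδ δ)}

/-- **C⁺ — convergence in law to chordal SLE_κ from subsequential identification alone**
(Literature-level sibling of `convergesInLawToSLE_of_isTightAlongMesh'`, with "tightness +
identification" replaced by "every positive null mesh sequence has a subsequence converging in
law to SOME chordal SLE_κ law of `(D; a, b)`"): no tightness, no probability instances, no
metrisation. From S1 and S2: the witness `Γ` is read off the harmonic mesh sequence; S2 pins
every subsequential limit law to the law of `Γ`, test function by test function; S1 concludes.
Billingsley (1999), Thm 2.6; Lawler (2005), §6.3. -/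
theorem convergesInLawToSLE_of_forall_pos_seq (h₁ : Registered.stub_seqCriterion)
    (h₂ : Registered.stub_uniqueLawIntegral)
    (hY : ∀ᶠ δ in 𝓝[>] (0 : ℝ), AEMeasurable (Y δ) (P δ))
    (h : ∀ s : ℕ → ℝ, (∀ n, 0 < s n) → Tendsto s atTop (𝓝 0) →
      ∃ φ : ℕ → ℕ, StrictMono φ ∧ ∃ μ : Measure (CurveClass ℂ), IsSLELaw κ D μ ∧
        ∀ f : CurveClass ℂ →ᵇ ℝ,
          Tendsto (fun n => ∫ ω, f (Y (s (φ n)) ω) ∂P (s (φ n))) atTop (𝓝 (∫ x, f x ∂μ))) :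
    ConvergesInLawToSLE κ D Y P := by
  -- the witness: one SLE_κ random curve in `D`, read off the harmonic mesh sequence `1/(n+1)`
  obtain ⟨-, -, μ₀, hμ₀, -⟩ := h (fun n => 1 / ((n : ℝ) + 1)) (fun n => Nat.one_div_pos_of_nat)
    tendsto_one_div_add_atTop_nhds_zero_nat
  obtain ⟨Γ, hΓ, -⟩ := hμ₀
  refine ⟨Γ, hΓ, hY, fun f => ?_⟩
  -- S1, one bounded continuous test function at a time, the target pinned by S2
  refine h₁ (fun δ => ∫ ω, f (Y δ ω) ∂P δ) _ fun s hspos hs0 => ?_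
  obtain ⟨φ, hφ, μ, hμ, hlim⟩ := h s hspos hs0
  refine ⟨φ, hφ, ?_⟩
  rw [← h₂ κ D μ Γ hμ hΓ f]
  exact hlim f

end Transfer

/-! ### The composition: the two stubs imply the crux, by name -/

/-- **`SubseqUpgrade` from the two stubs** (pure logic, no `sorry`): specialise clause (H2) to the
pair `(D, E)` at hand (its uniformity in `(D, E)` is not needed) and apply the transfer
`convergesInLawToSLE_of_forall_pos_seq` with `κ = 6`, `Ωδ := fun _ => BondConfig (Site 2)`,
`Y δ := bondInterfaceIn D (E δ)`, `P δ := bondPercolation (zdGraph 2) half`; clause (H1) is the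
measurability input `hY` verbatim. -/
theorem SubseqUpgrade_of (h₁ : Registered.stub_seqCriterion)
    (h₂ : Registered.stub_uniqueLawIntegral) :
    Summit.CriticalPhenomena.CardyFormulaZ2.Theses.CardySelfRefinement.SubseqUpgrade := by
  rintro ⟨hmeas, hsub⟩ D E hE
  refine convergesInLawToSLE_of_forall_pos_seq h₁ h₂ (hmeas D E hE) fun s hspos hs0 => ?_
  obtain ⟨φ, hφ, Pf, hPf, hconv⟩ := hsub s hspos hs0
  exact ⟨φ, hφ, Pf D, hPf D, fun f => hconv D E hE f⟩

/-- Wiring check: the registered (sorried) stubs feed `SubseqUpgrade_of` as stated. An `example`,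
so that `SubseqUpgrade_of` stays the only named theorem of this file concluding the crux. -/
example : Summit.CriticalPhenomena.CardyFormulaZ2.Theses.CardySelfRefinement.SubseqUpgrade :=
  SubseqUpgrade_of stub_seqCriterion stub_uniqueLawIntegral

end Summit.CriticalPhenomena.CardyFormulaZ2.Cruxes.SubseqUpgrade.UniquenessSubsequencePrinciple
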